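import Literature.Probability.LatticeModels.SlitPlanePrimitive
import Literature.Probability.LatticeModels.SlitPlaneAsymptotics
import Mathlib.Analysis.Fourier.RiemannLebesgueLemma
import Mathlib.Analysis.SumIntegralComparisons
import HarnessLib

/-!
# The slit-plane kernel, VI: growth and asymptotics of the discrete primitive `G`

Topic `Literature/Probability/LatticeModels`; sequel of `SlitPlanePrimitive.lean` (the closed form
of CHI's `G_{[ℂ_δ,a]}`) and `SlitPlaneAsymptotics.lean` (the expansion of the kernel `K`).
Chelkak–Hongler–Izyurov (Ann. of Math. 181 (2015) = arXiv:1202.2838), Lemma 2.16, assert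
`G_{[ℂ_δ,a]}(z) = O(|z - a|^{1/2})` and `ν(δ)⁻¹ G_{[ℂ_δ,a]} → Re √(z - a)` uniformly on compacts.
Here both become one explicit, uniform estimate on `ℤ²`:

  **`abs_slitG_sub_slitM_le`**: `|G(k, s) - M(k, s)| ≤ 1.1·10¹⁰` for all `k ∈ ℤ`, `s ≥ 1`, where
  `M(k, s) = √(2/π) Re[e^{-iπ/4} √(s + ik)]` (`slitM`, with the principal root `slitSqrt`,
  `slitSqrt_sq`) is the lattice sampling of `Re √(z - a)`; `M² = (‖a‖ + k)/π` (`slitM_sq`).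

The proof sums the expansion of `K` along the defining relation `G(k,s) - G(k-2,s) = K(k,s)`:
* `G(k, s) → 0` as `k → -∞` (`tendsto_slitG_atBot`): `G(k,s) - G(k,0)` is the Fourier
  coefficient of the integrable profile `(y^s - 1)(1 - e^{2it})^{-3/2}` (`slitG_sub_slitG_zero`),
  so it tends to `0` by the **Riemann–Lebesgue lemma** (Mathlib's
  `Real.tendsto_integral_exp_smul_cocompact`); on the row, even `k ≤ -2` are slit points and odd
  `k` follow from the row identity of `SlitPlanePrimitive.lean` and the Kesten bound
  (`tendsto_slitG_zero_atBot`);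
* `M(k, s) → 0` as `k → -∞` (`tendsto_slitM_atBot`, from `M² ≤ s²/|k|`);
* per step, `|K(k,s) - [M(k,s) - M(k-2,s)]| ≤ (6·10⁸ + 9)/‖a‖^{3/2}`
  (`abs_slitKernel_sub_slitM_sub_le`: the expansion `abs_slitKernel_sub_trig_le` of `K`, and
  `√a - √(a - 2i) = 2i/(√a + √(a - 2i))` for `M`, `abs_slitM_sub_sub_main_le`);
* the errors are summable uniformly: `∑_j ‖a_j‖^{-3/2} ≤ 18` along `a_j = s + i(k - 2j)`
  (`sum_inv_norm_mul_sqrt_le`, via `∑_{t<N} (t+1)^{-3/2} ≤ 3`, Mathlib's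
  `AntitoneOn.sum_le_integral_Ico`), and telescoping (`slitG_sub_iter`, `slitM_sub_iter`) with
  `J → ∞` gives the claim.

Also: the lower Wallis bound `binom(2m,m)/4^m ≥ 1/(2√m)` (`centralBinom_div_four_pow_ge`,
`slitKernel_two_mul_natCast_zero_ge`), which with `slitKernel_two_mul_natCast_zero_le` is the
two-sided estimate (2.16) `const·δ^{1/2} ≤ ϑ(δ) ≤ Const·δ^{1/2}` of the normalising factor.

Everything is proved; no named fact.

## References

* D. Chelkak, C. Hongler, K. Izyurov, Ann. of Math. 181 (2015) = arXiv:1202.2838: Lemma 2.16 and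
  (2.16), §3.2.3 [ChelkakHonglerIzyurovAnnals2015].
-/

noncomputable section

open Complex MeasureTheory intervalIntegral Set Filter Topology Metric
open scoped Real ComplexConjugate Interval FourierTransform

namespace Literature.Probability.LatticeModels

/-! ### `G(k, s) - G(k, 0)` is a Fourier coefficient of an integrable function -/

/-- The `k`-independent profile `h_s(t) = (y(t)^s - 1)(1 - e^{2it})^{-3/2}`. [folklore] -/
def slitGProfile (s : ℕ) (t : ℝ) : ℂ := ((((chmY t) ^ s - 1 : ℝ)) : ℂ) * circBase 1 (2 * t) ^ (-(3 / 2 : ℂ))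

/-- `slitGFun k s - slitGFun k 0 = e^{-ikt} h_s(t)`. [folklore] -/
theorem slitGFun_sub_slitGFun_zero (k : ℤ) (s : ℕ) (t : ℝ) :
    slitGFun k s t - slitGFun k 0 t = cexp (-((k : ℂ) * (t : ℂ) * I)) * slitGProfile s t := by
  unfold slitGFun slitGProfile
  push_cast
  ring

/-- The profile is measurable. [folklore] -/
theorem measurable_slitGProfile (s : ℕ) : Measurable (slitGProfile s) := by
  unfold slitGProfile
  refine Measurable.mul ?_ ?_
  · exact (continuous_ofReal.comp ((continuous_chmY.pow s).sub continuous_const)).measurable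
  · exact ((continuous_circBase 1).comp (continuous_const.mul continuous_id)).measurable.pow_const _

/-- `‖h_s(t)‖ ≤ 2s |t|^{-1/2}` for `0 < |t| ≤ π/2`. [folklore] -/
theorem norm_slitGProfile_le (s : ℕ) {t : ℝ} (ht : |t| ≤ π / 2) (h0 : t ≠ 0) :
    ‖slitGProfile s t‖ ≤ 2 * s * |t| ^ (-(1 / 2 : ℝ)) := by
  have hy0 := chmY_nonneg ht
  have hy1 := chmY_le_one t
  have h1 : ‖((((chmY t) ^ s - 1 : ℝ)) : ℂ)‖ ≤ 2 * s * |t| := by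
    rw [Complex.norm_real, Real.norm_eq_abs, abs_sub_comm, abs_of_nonneg (by linarith [pow_le_one₀ hy0 hy1 (n := s)])]
    have := one_sub_pow_le_mul hy0 hy1 s
    have := one_sub_chmY_le t
    nlinarith
  have h2 := norm_circBase_cpow_neg_three_halves_le ht h0
  have hpos : 0 < |t| := abs_pos.2 h0
  rw [slitGProfile, norm_mul]
  calc ‖((((chmY t) ^ s - 1 : ℝ)) : ℂ)‖ * ‖circBase 1 (2 * t) ^ (-(3 / 2 : ℂ))‖
      ≤ (2 * s * |t|) * |t| ^ (-(3 / 2 : ℝ)) := mul_le_mul h1 h2 (norm_nonneg _) (by positivity)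
    _ = 2 * s * |t| ^ (-(1 / 2 : ℝ)) := by
        rw [mul_assoc, show -(1 / 2 : ℝ) = 1 + (-(3 / 2 : ℝ)) by norm_num, Real.rpow_add hpos, Real.rpow_one]

/-- The profile, extended by zero, is integrable on `ℝ`. [folklore] -/
theorem integrable_indicator_slitGProfile (s : ℕ) :
    Integrable ((Icc (-(π / 2)) (π / 2)).indicator (slitGProfile s)) := by
  rw [integrable_indicator_iff measurableSet_Icc]
  have h : IntervalIntegrable (slitGProfile s) volume (-(π / 2)) (π / 2) := by
    refine ((intervalIntegrable_abs_rpow (by norm_num : (-1 : ℝ) < -(1 / 2)) _ _).const_mul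
      (2 * s)).mono_fun' (measurable_slitGProfile s).aestronglyMeasurable ?_
    rw [EventuallyLE, ae_restrict_iff' measurableSet_uIoc]
    filter_upwards [ae_ne_zero] with t h0 ht
    exact norm_slitGProfile_le s (abs_le_of_mem_uIoc_half_pi ht) h0
  have hle : -(π / 2) ≤ π / 2 := by linarith [Real.pi_pos]
  rw [intervalIntegrable_iff_integrableOn_Icc_of_le hle] at h
  exact h

/-- **`G(k, s) - G(k, 0) = (1/π) Re ∫_{-π/2}^{π/2} e^{-ikt} h_s(t) dt`.** [folklore] -/
theorem slitG_sub_slitG_zero (k : ℤ) (s : ℕ) :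
    slitG k s - slitG k 0 = 1 / π * (∫ t in (-(π / 2))..(π / 2), cexp (-((k : ℂ) * (t : ℂ) * I)) * slitGProfile s t).re := by
  have hI := intervalIntegrable_slitGFun
  rw [slitG, slitG]
  have h1 : (∫ t in (-(π / 2))..(π / 2), (slitGFun k s t).re) - ∫ t in (-(π / 2))..(π / 2), (slitGFun k 0 t).re =
      ∫ t in (-(π / 2))..(π / 2), (slitGFun k s t - slitGFun k 0 t).re := by
    rw [← intervalIntegral.integral_sub (intervalIntegrable_slitGFun_re k s) (intervalIntegrable_slitGFun_re k 0)]
    rfl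
  have h2 : ∫ t in (-(π / 2))..(π / 2), (slitGFun k s t - slitGFun k 0 t).re =
      (∫ t in (-(π / 2))..(π / 2), (slitGFun k s t - slitGFun k 0 t)).re := by
    have h := intervalIntegral_re ((hI k s).sub (hI k 0))
    simpa only [RCLike.re_to_complex] using h
  rw [show 1 + 1 / π * (∫ t in (-(π / 2))..(π / 2), (slitGFun k s t).re) - (1 + 1 / π * ∫ t in (-(π / 2))..(π / 2), (slitGFun k 0 t).re) =
    1 / π * ((∫ t in (-(π / 2))..(π / 2), (slitGFun k s t).re) - ∫ t in (-(π / 2))..(π / 2), (slitGFun k 0 t).re) by ring,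
    h1, h2]
  congr 2
  exact intervalIntegral.integral_congr fun t _ => slitGFun_sub_slitGFun_zero k s t

/-- The Fourier form: `∫_{-π/2}^{π/2} e^{-ikt} h_s = ∫_ℝ 𝐞(-(t · k/(2π))) • (𝟙 h_s)(t) dt`. [folklore] -/
theorem integral_eq_fourier_form (k : ℤ) (s : ℕ) :
    ∫ t in (-(π / 2))..(π / 2), cexp (-((k : ℂ) * (t : ℂ) * I)) * slitGProfile s t =
      ∫ t : ℝ, 𝐞 (-(t * ((k : ℝ) / (2 * π)))) • (Icc (-(π / 2)) (π / 2)).indicator (slitGProfile s) t := by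
  have hπ := Real.pi_pos
  have hle : -(π / 2) ≤ π / 2 := by linarith
  rw [intervalIntegral.integral_of_le hle, ← integral_Icc_eq_integral_Ioc, ← MeasureTheory.integral_indicator measurableSet_Icc]
  refine integral_congr_ae (Eventually.of_forall fun t => ?_)
  change (Icc (-(π / 2)) (π / 2)).indicator (fun t => cexp (-((k : ℂ) * (t : ℂ) * I)) * slitGProfile s t) t =
    𝐞 (-(t * ((k : ℝ) / (2 * π)))) • (Icc (-(π / 2)) (π / 2)).indicator (slitGProfile s) t
  by_cases ht : t ∈ Icc (-(π / 2)) (π / 2)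
  · rw [indicator_of_mem ht, indicator_of_mem ht, Circle.smul_def, Real.fourierChar_apply, smul_eq_mul]
    congr 1
    congr 1
    push_cast
    field_simp
  · rw [indicator_of_notMem ht, indicator_of_notMem ht, smul_zero]

/-- **Riemann–Lebesgue**: `G(k, s) - G(k, 0) → 0` as `k → -∞`. [folklore] -/
theorem tendsto_slitG_sub_slitG_zero_atBot (s : ℕ) : Tendsto (fun k : ℤ => slitG k s - slitG k 0) atBot (𝓝 0) := by
  have hπ := Real.pi_pos
  have hRL := Real.tendsto_integral_exp_smul_cocompact ((Icc (-(π / 2)) (π / 2)).indicator (slitGProfile s))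
  have hmap : Tendsto (fun k : ℤ => (k : ℝ) / (2 * π)) atBot (cocompact ℝ) := by
    have h0 : Tendsto ((↑) : ℤ → ℝ) atBot atBot := tendsto_intCast_atBot_iff.2 tendsto_id
    have h1 : Tendsto (fun k : ℤ => (k : ℝ) / (2 * π)) atBot atBot := h0.atBot_div_const (by positivity)
    rw [cocompact_eq_atBot_atTop]; exact h1.mono_right le_sup_left
  have h := hRL.comp hmap
  have h2 : Tendsto (fun k : ℤ => 1 / π * (∫ t : ℝ, 𝐞 (-(t * ((k : ℝ) / (2 * π)))) •
      (Icc (-(π / 2)) (π / 2)).indicator (slitGProfile s) t).re) atBot (𝓝 (1 / π * (0 : ℂ).re)) :=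
    ((Complex.continuous_re.tendsto _).comp h).const_mul _
  rw [Complex.zero_re, mul_zero] at h2
  refine h2.congr fun k => ?_
  rw [slitG_sub_slitG_zero, integral_eq_fourier_form]

/-! ### `G(k, 0) → 0` and `G(k, s) → 0` as `k → -∞` -/

/-- **On the negative row `G(k, 0) → 0`** (`k → -∞`): even `k` are slit points (`G = 0`), odd `k`
by the row identity `G(k,0) = ½[G(k-1,1) + G(k+1,1)] - ½K(-k-2,0)`. [folklore] -/
theorem tendsto_slitG_zero_atBot : Tendsto (fun k : ℤ => slitG k 0) atBot (𝓝 0) := by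
  have h1 := tendsto_slitG_sub_slitG_zero_atBot 1
  rw [Metric.tendsto_nhds] at h1 ⊢
  intro ε hε
  obtain ⟨N₁, hN₁⟩ := Filter.eventually_atBot.1 (h1 (ε / 2) (by positivity))
  refine Filter.eventually_atBot.2 ?_
  -- Kesten bound: `|K(-k-2, 0)| ≤ 8/√(1 + |k+2|) < ε` for `k ≤ N₂`
  obtain ⟨N₂, hN₂⟩ : ∃ N₂ : ℤ, ∀ k ≤ N₂, |slitKernel (-k - 2) 0| < ε := by
    refine ⟨-(⌈(8 / ε) ^ 2⌉ + 3), fun k hk => ?_⟩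
    refine (abs_slitKernel_le (-k - 2) 0).trans_lt ?_
    have hk' : (k : ℝ) ≤ -(⌈(8 / ε) ^ 2⌉ + 3 : ℤ) := by exact_mod_cast hk
    push_cast at hk'
    have hceil := Int.le_ceil ((8 / ε) ^ 2)
    have habs : (8 / ε) ^ 2 < 1 + |((-k - 2 : ℤ) : ℝ)| + ((0 : ℕ) : ℝ) := by
      push_cast
      have : (8 / ε) ^ 2 + 1 ≤ -(k : ℝ) - 2 := by linarith
      have h2 : -(k : ℝ) - 2 ≤ |-(k : ℝ) - 2| := le_abs_self _
      linarith
    rw [div_lt_iff₀ (Real.sqrt_pos.2 (by positivity))]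
    have h3 : 8 / ε < Real.sqrt (1 + |((-k - 2 : ℤ) : ℝ)| + ((0 : ℕ) : ℝ)) := by
      rw [Real.lt_sqrt (by positivity)]; exact habs
    have := (div_lt_iff₀ hε).1 h3
    linarith
  refine ⟨min (min N₁ N₂) (-2) - 1, fun k hk => ?_⟩
  rw [Real.dist_eq, sub_zero]
  rcases Int.even_or_odd k with ⟨m, hm⟩ | ⟨m, hm⟩
  · -- even `k = 2m' ≤ -2` hmm: `k = m + m`
    have hk2 : k ≤ -2 := by omega
    obtain ⟨j, hj⟩ : ∃ j : ℕ, k = -(2 * (j : ℤ)) ∧ 1 ≤ j := ⟨(-m).toNat, by omega, by omega⟩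
    rw [hj.1, slitG_slit j hj.2, abs_zero]; exact hε
  · -- odd `k`: row identity
    have hrow := slitG_row k
    have hkm1 : k - 1 ≤ N₁ := by omega
    have hkp1 : k + 1 ≤ N₁ := by omega
    have he1 := hN₁ (k - 1) hkm1
    have he2 := hN₁ (k + 1) hkp1
    rw [Real.dist_eq, sub_zero] at he1 he2
    -- `G(k ± 1, 0) = 0` (even, `≤ -2`)
    obtain ⟨j1, hj1⟩ : ∃ j : ℕ, k - 1 = -(2 * (j : ℤ)) ∧ 1 ≤ j := ⟨(-m).toNat, by omega, by omega⟩
    obtain ⟨j2, hj2⟩ : ∃ j : ℕ, k + 1 = -(2 * (j : ℤ)) ∧ 1 ≤ j := ⟨(-m - 1).toNat, by omega, by omega⟩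
    have hz1 : slitG (k - 1) 0 = 0 := by rw [hj1.1]; exact slitG_slit j1 hj1.2
    have hz2 : slitG (k + 1) 0 = 0 := by rw [hj2.1]; exact slitG_slit j2 hj2.2
    rw [hz1, sub_zero] at he1
    rw [hz2, sub_zero] at he2
    have hK := hN₂ k (by omega)
    have : slitG k 0 = 1 / 2 * (slitG (k - 1) 1 + slitG (k + 1) 1) + -(1 / 2) * slitKernel (-k - 2) 0 := by linarith
    rw [this]
    calc |1 / 2 * (slitG (k - 1) 1 + slitG (k + 1) 1) + -(1 / 2) * slitKernel (-k - 2) 0|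
        ≤ |1 / 2 * (slitG (k - 1) 1 + slitG (k + 1) 1)| + |-(1 / 2) * slitKernel (-k - 2) 0| := abs_add_le _ _
      _ ≤ 1 / 2 * (|slitG (k - 1) 1| + |slitG (k + 1) 1|) + 1 / 2 * |slitKernel (-k - 2) 0| := by
          rw [abs_mul, abs_mul, abs_of_pos (by norm_num : (0 : ℝ) < 1 / 2), abs_neg, abs_of_pos (by norm_num : (0 : ℝ) < 1 / 2)]
          gcongr; exact abs_add_le _ _
      _ < 1 / 2 * (ε / 2 + ε / 2) + 1 / 2 * ε := by gcongr
      _ = ε := by ring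

/-- **`G(k, s) → 0` as `k → -∞`**, for every `s`. [folklore] -/
theorem tendsto_slitG_atBot (s : ℕ) : Tendsto (fun k : ℤ => slitG k s) atBot (𝓝 0) := by
  have h := (tendsto_slitG_sub_slitG_zero_atBot s).add tendsto_slitG_zero_atBot
  simp only [sub_add_cancel, add_zero] at h
  exact h


/-! ### The continuum primitive `M(k, s) = √(2/π) Re[e^{-iπ/4} √a]` and its differences -/

/-- The principal square root of `a = s + ik`: `√‖a‖ · conj(e^{iθ_a}) = √‖a‖ e^{i arg(a)/2}`. [folklore] -/
def slitSqrt (k : ℤ) (s : ℕ) : ℂ := (Real.sqrt ‖slitParam k s‖ : ℂ) * conj (cexp ((rotAngle k s : ℂ) * I))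

/-- `conj(e^{iθ}) = e^{-iθ}`. [folklore] -/
theorem conj_cexp_ofReal_mul_I (θ : ℝ) : conj (cexp ((θ : ℂ) * I)) = cexp (-((θ : ℂ) * I)) := by
  rw [← Complex.exp_conj, map_mul, Complex.conj_ofReal, Complex.conj_I]; ring_nf

/-- `(√a)² = a`. [folklore] -/
theorem slitSqrt_sq (k : ℤ) (s : ℕ) : slitSqrt k s ^ 2 = slitParam k s := by
  have ha := Complex.norm_mul_exp_arg_mul_I (slitParam k s)
  rw [slitSqrt, conj_cexp_ofReal_mul_I, mul_pow, ← Complex.exp_nat_mul, ← ofReal_pow, Real.sq_sqrt (norm_nonneg _), rotAngle,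
    show ((2 : ℕ) : ℂ) * -((((-(slitParam k s).arg / 2 : ℝ)) : ℂ) * I) = (slitParam k s).arg * I by push_cast; ring]
  exact ha

/-- `‖√a‖ = √‖a‖`. [folklore] -/
theorem norm_slitSqrt (k : ℤ) (s : ℕ) : ‖slitSqrt k s‖ = Real.sqrt ‖slitParam k s‖ := by
  rw [slitSqrt, norm_mul, Complex.norm_real, Real.norm_eq_abs, abs_of_nonneg (Real.sqrt_nonneg _), Complex.norm_conj,
    Complex.norm_exp_ofReal_mul_I, mul_one]

/-- `Re √a = √‖a‖ cos θ_a`. [folklore] -/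
theorem slitSqrt_re (k : ℤ) (s : ℕ) : (slitSqrt k s).re = Real.sqrt ‖slitParam k s‖ * Real.cos (rotAngle k s) := by
  rw [slitSqrt, conj_cexp_ofReal_mul_I, show -((rotAngle k s : ℂ) * I) = ((-rotAngle k s : ℝ) : ℂ) * I by push_cast; ring,
    re_ofReal_mul, Complex.exp_ofReal_mul_I_re, Real.cos_neg]

/-- `Re √a ≥ √‖a‖ / 2`. [folklore] -/
theorem half_sqrt_le_slitSqrt_re (k : ℤ) {s : ℕ} (hs : 1 ≤ s) : Real.sqrt ‖slitParam k s‖ / 2 ≤ (slitSqrt k s).re := by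
  have hπ := Real.pi_pos
  have hθ := abs_rotAngle_lt k hs
  rw [slitSqrt_re]
  have hc : Real.cos (π / 3) ≤ Real.cos (rotAngle k s) := by
    rw [← Real.cos_abs (rotAngle k s)]
    exact Real.cos_le_cos_of_nonneg_of_le_pi (abs_nonneg _) (by linarith) (by linarith)
  rw [Real.cos_pi_div_three] at hc
  have h0 := Real.sqrt_nonneg ‖slitParam k s‖
  nlinarith

/-- `a(k-2, s) = a(k, s) - 2i`. [folklore] -/
theorem slitParam_sub_two (k : ℤ) (s : ℕ) : slitParam (k - 2) s = slitParam k s - 2 * I := by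
  simp only [slitParam]; push_cast; ring

/-- **The continuum primitive** `M(k, s) = √(2/π) Re[e^{-iπ/4} √a]`: the lattice sampling of
`Re √(z - a)` in the normalisation of `K`. [folklore] -/
def slitM (k : ℤ) (s : ℕ) : ℝ := Real.sqrt (2 / π) * (cexp (-(π / 4) * I) * slitSqrt k s).re

/-- `Re[e^{-iπ/4} √a] = √‖a‖ cos(π/4 + θ_a)`. [folklore] -/
theorem re_rot_slitSqrt (k : ℤ) (s : ℕ) :
    (cexp (-(π / 4) * I) * slitSqrt k s).re = Real.sqrt ‖slitParam k s‖ * Real.cos (π / 4 + rotAngle k s) := by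
  rw [slitSqrt, conj_cexp_ofReal_mul_I, show cexp (-(π / 4) * I) * ((Real.sqrt ‖slitParam k s‖ : ℂ) * cexp (-((rotAngle k s : ℂ) * I))) =
    ((Real.sqrt ‖slitParam k s‖ : ℝ) : ℂ) * (cexp (-(π / 4) * I) * cexp (-((rotAngle k s : ℂ) * I))) by ring,
    ← Complex.exp_add, show -(π / 4) * I + -((rotAngle k s : ℂ) * I) = ((-(π / 4 + rotAngle k s) : ℝ) : ℂ) * I by push_cast; ring,
    re_ofReal_mul, Complex.exp_ofReal_mul_I_re, Real.cos_neg]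

/-- **`M² = (‖a‖ + k)/π`.** [folklore] -/
theorem slitM_sq (k : ℤ) {s : ℕ} (hs : 1 ≤ s) : slitM k s ^ 2 = (‖slitParam k s‖ + k) / π := by
  have hπ := Real.pi_pos
  have hn : 0 < ‖slitParam k s‖ := by linarith [one_le_norm_slitParam k hs]
  rw [slitM, re_rot_slitSqrt, mul_pow, mul_pow, Real.sq_sqrt (by positivity), Real.sq_sqrt hn.le, cos_sq_quarter_add_rotAngle k hs]
  field_simp

/-- `M(k, s)² ≤ s²/|k|` for `k < 0`. [folklore] -/
theorem slitM_sq_le {k : ℤ} (hk : k < 0) {s : ℕ} (hs : 1 ≤ s) : slitM k s ^ 2 ≤ (s : ℝ) ^ 2 / |(k : ℝ)| := by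
  have hπ := Real.pi_gt_three
  set n := ‖slitParam k s‖ with hn
  have hn1 : 1 ≤ n := one_le_norm_slitParam k hs
  have hsq := norm_slitParam_sq k s
  rw [← hn] at hsq
  have hk' : (k : ℝ) < 0 := by exact_mod_cast hk
  have hkabs : |(k : ℝ)| = -k := abs_of_neg hk'
  have hkn : |(k : ℝ)| ≤ n := by rw [hn, ← slitParam_im k s]; exact abs_im_le_norm _
  rw [hkabs] at hkn
  rw [slitM_sq k hs, ← hn, hkabs, div_le_div_iff₀ (by linarith) (by linarith)]
  have hprod : (n + k) * (n - k) = (s : ℝ) ^ 2 := by nlinarith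
  have hnk : 0 ≤ n + k := by linarith
  have h1 : (n + k) * (-(k : ℝ)) ≤ (n + k) * (n - k) := mul_le_mul_of_nonneg_left (by linarith) hnk
  nlinarith

/-- **`M(k, s) → 0` as `k → -∞`.** [folklore] -/
theorem tendsto_slitM_atBot {s : ℕ} (hs : 1 ≤ s) : Tendsto (fun k : ℤ => slitM k s) atBot (𝓝 0) := by
  rw [Metric.tendsto_nhds]
  intro ε hε
  refine Filter.eventually_atBot.2 ⟨-(⌈(s : ℝ) ^ 2 / ε ^ 2⌉ + 1), fun k hk => ?_⟩
  rw [Real.dist_eq, sub_zero]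
  have hc0 : (0 : ℤ) ≤ ⌈(s : ℝ) ^ 2 / ε ^ 2⌉ := Int.ceil_nonneg (by positivity)
  have hk0 : k < 0 := by omega
  have h := slitM_sq_le hk0 hs
  have hk' : (k : ℝ) ≤ -(⌈(s : ℝ) ^ 2 / ε ^ 2⌉ + 1 : ℤ) := by exact_mod_cast hk
  push_cast at hk'
  have hceil := Int.le_ceil ((s : ℝ) ^ 2 / ε ^ 2)
  have hkpos : 0 < |(k : ℝ)| := abs_pos.2 (by exact_mod_cast hk0.ne)
  have habs : (s : ℝ) ^ 2 / ε ^ 2 < |(k : ℝ)| := by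
    rw [abs_of_neg (by exact_mod_cast hk0)]; linarith
  have h2 : (s : ℝ) ^ 2 / |(k : ℝ)| < ε ^ 2 := by
    rw [div_lt_iff₀ hkpos]
    rw [div_lt_iff₀ (by positivity)] at habs
    linarith
  exact abs_lt.2 (abs_lt_of_sq_lt_sq' (h.trans_lt h2) hε.le)

/-- **The difference of the continuum primitive matches the leading term of `K`**:
`|[M(k,s) - M(k-2,s)] - √(2/(π‖a‖)) cos(π/4 + θ_a)| ≤ 8/(‖a‖√‖a‖)`. [folklore] -/
theorem abs_slitM_sub_sub_main_le (k : ℤ) {s : ℕ} (hs : 1 ≤ s) :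
    |slitM k s - slitM (k - 2) s - Real.sqrt (2 / (π * ‖slitParam k s‖)) * Real.cos (π / 4 + rotAngle k s)| ≤
      8 / (‖slitParam k s‖ * Real.sqrt ‖slitParam k s‖) := by
  have hπ := Real.pi_pos
  have hπ3 := Real.pi_gt_three
  set n := ‖slitParam k s‖ with hn
  have hn1 : 1 ≤ n := one_le_norm_slitParam k hs
  have hn0 : 0 < n := by linarith
  set r := slitSqrt k s with hr
  set r' := slitSqrt (k - 2) s with hr'
  have hsn : 0 < Real.sqrt n := Real.sqrt_pos.2 hn0
  have hre : Real.sqrt n / 2 ≤ r.re := by rw [hr, hn]; exact half_sqrt_le_slitSqrt_re k hs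
  have hre' : 0 < r'.re := by
    have h := half_sqrt_le_slitSqrt_re (k - 2) hs
    have : 0 < Real.sqrt ‖slitParam (k - 2) s‖ := Real.sqrt_pos.2 (by linarith [one_le_norm_slitParam (k - 2) hs])
    rw [← hr'] at h; linarith
  have hsum_re : Real.sqrt n / 2 ≤ (r + r').re := by rw [Complex.add_re]; linarith
  have hr0 : r ≠ 0 := by intro h; rw [h, Complex.zero_re] at hre; linarith
  have hsum0 : r + r' ≠ 0 := by intro h; rw [h, Complex.zero_re] at hsum_re; linarith
  have hnr : ‖r‖ = Real.sqrt n := by rw [hr, hn]; exact norm_slitSqrt k s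
  have hsum_norm : Real.sqrt n / 2 ≤ ‖r + r'‖ := hsum_re.trans (Complex.re_le_norm _)
  -- `r² - r'² = 2i`, so `r - r' = 2i/(r + r')`
  have hsq : r ^ 2 - r' ^ 2 = 2 * I := by
    rw [hr, hr', slitSqrt_sq, slitSqrt_sq, slitParam_sub_two]; ring
  have hdiff : r - r' = 2 * I / (r + r') := by
    rw [eq_div_iff hsum0]; linear_combination hsq
  -- `r⁻¹ = e^{iθ}/√n`
  have he : cexp ((rotAngle k s : ℂ) * I) * conj (cexp ((rotAngle k s : ℂ) * I)) = 1 := by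
    rw [conj_cexp_ofReal_mul_I, ← Complex.exp_add, add_neg_cancel, Complex.exp_zero]
  have hsn0 : ((Real.sqrt n : ℝ) : ℂ) ≠ 0 := by exact_mod_cast hsn.ne'
  have hinv : r⁻¹ = (((Real.sqrt n)⁻¹ : ℝ) : ℂ) * cexp ((rotAngle k s : ℂ) * I) := by
    have h2 : r * ((((Real.sqrt n)⁻¹ : ℝ) : ℂ) * cexp ((rotAngle k s : ℂ) * I)) = 1 := by
      rw [hr, slitSqrt, ← hn]
      calc ((Real.sqrt n : ℝ) : ℂ) * conj (cexp ((rotAngle k s : ℂ) * I)) * ((((Real.sqrt n)⁻¹ : ℝ) : ℂ) * cexp ((rotAngle k s : ℂ) * I))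
          = ((Real.sqrt n : ℝ) : ℂ) * (((Real.sqrt n)⁻¹ : ℝ) : ℂ) * (cexp ((rotAngle k s : ℂ) * I) * conj (cexp ((rotAngle k s : ℂ) * I))) := by
            ring
        _ = 1 := by rw [he, mul_one]; push_cast; field_simp
    exact (eq_inv_of_mul_eq_one_right h2).symm
  -- the leading term of `K` is `√(2/π) Re[e^{-iπ/4} · i r⁻¹]`
  have hI4 : cexp (-(π / 4) * I) * I = cexp ((π / 4 : ℂ) * I) := by
    have h4 : cexp ((π / 2 : ℂ) * I) = I := by
      rw [show (π / 2 : ℂ) * I = ((π / 2 : ℝ) : ℂ) * I by push_cast; ring, Complex.exp_mul_I, ← ofReal_cos, ← ofReal_sin,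
        Real.cos_pi_div_two, Real.sin_pi_div_two]; simp
    rw [show cexp (-(π / 4) * I) * I = cexp (-(π / 4) * I) * cexp ((π / 2 : ℂ) * I) by rw [h4], ← Complex.exp_add]
    congr 1; ring
  have hmain : Real.sqrt (2 / (π * n)) * Real.cos (π / 4 + rotAngle k s) =
      Real.sqrt (2 / π) * (cexp (-(π / 4) * I) * (I * r⁻¹)).re := by
    rw [hinv, show cexp (-(π / 4) * I) * (I * ((((Real.sqrt n)⁻¹ : ℝ) : ℂ) * cexp ((rotAngle k s : ℂ) * I))) =
      (((Real.sqrt n)⁻¹ : ℝ) : ℂ) * ((cexp (-(π / 4) * I) * I) * cexp ((rotAngle k s : ℂ) * I)) by ring, hI4, ← Complex.exp_add,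
      show (π / 4 : ℂ) * I + (rotAngle k s : ℂ) * I = ((π / 4 + rotAngle k s : ℝ) : ℂ) * I by push_cast; ring,
      re_ofReal_mul, Complex.exp_ofReal_mul_I_re, ← mul_assoc]
    congr 1
    rw [Real.sqrt_div' _ (by positivity), Real.sqrt_mul (by positivity), Real.sqrt_div' _ hπ.le]
    field_simp
  -- the key algebraic identity
  have hden : r * (r + r') ^ 2 ≠ 0 := mul_ne_zero hr0 (pow_ne_zero 2 hsum0)
  have hXY : (r - r') - I * r⁻¹ = -2 / (r * (r + r') ^ 2) := by
    rw [hdiff, eq_div_iff hden, sub_mul]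
    have e1 : 2 * I / (r + r') * (r * (r + r') ^ 2) = 2 * I * r * (r + r') := by field_simp
    have e2 : I * r⁻¹ * (r * (r + r') ^ 2) = I * (r + r') ^ 2 := by field_simp
    rw [e1, e2]
    linear_combination I * hsq + 2 * Complex.I_sq
  have hkey : slitM k s - slitM (k - 2) s - Real.sqrt (2 / (π * n)) * Real.cos (π / 4 + rotAngle k s) =
      Real.sqrt (2 / π) * (cexp (-(π / 4) * I) * (-2 / (r * (r + r') ^ 2))).re := by
    rw [hmain, ← hXY]
    simp only [slitM, ← hr, ← hr']
    rw [← mul_sub, ← mul_sub, ← Complex.sub_re, ← Complex.sub_re, ← mul_sub, ← mul_sub]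
  rw [hkey, abs_mul, abs_of_nonneg (Real.sqrt_nonneg _)]
  have hs2 : Real.sqrt (2 / π) ≤ 1 := by
    rw [Real.sqrt_le_left zero_le_one, one_pow, div_le_one hπ]; linarith
  have hnorm : |(cexp (-(π / 4) * I) * (-2 / (r * (r + r') ^ 2))).re| ≤ 8 / (n * Real.sqrt n) := by
    refine (abs_re_le_norm _).trans ?_
    rw [norm_mul, show (-(π / 4) : ℂ) * I = ((-(π / 4) : ℝ) : ℂ) * I by push_cast; ring, Complex.norm_exp_ofReal_mul_I, one_mul,
      norm_div, norm_neg, norm_mul, norm_pow, hnr]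
    rw [div_le_div_iff₀ (by positivity) (by positivity)]
    have h2 : n / 4 ≤ ‖r + r'‖ ^ 2 := by nlinarith [Real.sq_sqrt hn0.le, norm_nonneg (r + r')]
    have h3 : ‖(2 : ℂ)‖ = 2 := by simp
    rw [h3]
    nlinarith [Real.sq_sqrt hn0.le, mul_le_mul_of_nonneg_left h2 hsn.le]
  calc Real.sqrt (2 / π) * |(cexp (-(π / 4) * I) * (-2 / (r * (r + r') ^ 2))).re| ≤ 1 * (8 / (n * Real.sqrt n)) :=
        mul_le_mul hs2 hnorm (abs_nonneg _) zero_le_one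
    _ = 8 / (n * Real.sqrt n) := one_mul _

/-- **Per-term comparison**: `|K(k,s) - [M(k,s) - M(k-2,s)]| ≤ (6·10⁸ + 9)/(‖a‖√‖a‖)`. [folklore] -/
theorem abs_slitKernel_sub_slitM_sub_le (k : ℤ) {s : ℕ} (hs : 1 ≤ s) :
    |slitKernel k s - (slitM k s - slitM (k - 2) s)| ≤ 600000009 / (‖slitParam k s‖ * Real.sqrt ‖slitParam k s‖) := by
  have hπ := Real.pi_pos
  have hπ3 := Real.pi_gt_three
  set n := ‖slitParam k s‖ with hn
  have hn1 : 1 ≤ n := one_le_norm_slitParam k hs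
  have hn0 : 0 < n := by linarith
  have hsq1 : 1 ≤ Real.sqrt n := by rw [Real.le_sqrt (by norm_num) hn0.le]; linarith
  have hsqn : Real.sqrt n ≤ n := by rw [Real.sqrt_le_left hn0.le]; nlinarith
  have h1 := abs_slitKernel_sub_trig_le k hs
  have h2 := abs_slitM_sub_sub_main_le k hs
  rw [← hn] at h1 h2
  have hcoef : Real.sqrt (2 / (π * n)) ≤ 1 / Real.sqrt n := by
    rw [Real.sqrt_le_left (by positivity), div_pow, one_pow, Real.sq_sqrt hn0.le, div_le_div_iff₀ (by positivity) hn0]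
    nlinarith
  have hcorr : |Real.sqrt (2 / (π * n)) * (Real.sin (π / 4 + 3 * rotAngle k s) / (4 * n))| ≤ 1 / (n * Real.sqrt n) := by
    rw [abs_mul, abs_of_nonneg (Real.sqrt_nonneg _), abs_div, abs_of_pos (show (0 : ℝ) < 4 * n by positivity)]
    calc Real.sqrt (2 / (π * n)) * (|Real.sin (π / 4 + 3 * rotAngle k s)| / (4 * n)) ≤ 1 / Real.sqrt n * (1 / (4 * n)) := by
          refine mul_le_mul hcoef ?_ (by positivity) (by positivity)
          exact div_le_div_of_nonneg_right (Real.abs_sin_le_one _) (by positivity)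
      _ ≤ 1 / (n * Real.sqrt n) := by
          rw [div_mul_div_comm, one_mul, div_le_div_iff₀ (by positivity) (by positivity)]; nlinarith
  have herr : 600000000 / n ^ 2 ≤ 600000000 / (n * Real.sqrt n) := by
    apply div_le_div_of_nonneg_left (by norm_num) (by positivity); nlinarith
  have key : slitKernel k s - (slitM k s - slitM (k - 2) s) =
      (slitKernel k s - Real.sqrt (2 / (π * n)) * (Real.cos (π / 4 + rotAngle k s) + Real.sin (π / 4 + 3 * rotAngle k s) / (4 * n))) +
      Real.sqrt (2 / (π * n)) * (Real.sin (π / 4 + 3 * rotAngle k s) / (4 * n)) -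
      (slitM k s - slitM (k - 2) s - Real.sqrt (2 / (π * n)) * Real.cos (π / 4 + rotAngle k s)) := by ring
  rw [key]
  refine (abs_sub _ _).trans ?_
  refine (add_le_add ((abs_add_le _ _).trans (add_le_add h1 hcorr)) h2).trans ?_
  rw [show (600000009 : ℝ) / (n * Real.sqrt n) = 600000000 / (n * Real.sqrt n) + 1 / (n * Real.sqrt n) + 8 / (n * Real.sqrt n) by ring]
  linarith

/-! ### Summation: `G(k, s) = M(k, s) + O(1)` -/

/-- Telescoping `G`: `G(k, s) - G(k - 2J, s) = ∑_{j<J} K(k - 2j, s)`. [folklore] -/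
theorem slitG_sub_iter (k : ℤ) (s : ℕ) (J : ℕ) :
    slitG k s - slitG (k - 2 * J) s = ∑ j ∈ Finset.range J, slitKernel (k - 2 * j) s := by
  induction J with
  | zero => simp
  | succ n ih =>
    rw [Finset.sum_range_succ, ← ih]
    have h := slitG_sub (k - 2 * n) s
    rw [show (k - 2 * (n : ℤ) - 2) = k - 2 * ((n + 1 : ℕ) : ℤ) by push_cast; ring] at h
    linarith

/-- Telescoping `M`. [folklore] -/
theorem slitM_sub_iter (k : ℤ) (s : ℕ) (J : ℕ) :
    slitM k s - slitM (k - 2 * J) s = ∑ j ∈ Finset.range J, (slitM (k - 2 * j) s - slitM (k - 2 * j - 2) s) := by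
  induction J with
  | zero => simp
  | succ n ih =>
    rw [Finset.sum_range_succ, ← ih, show (k - 2 * (n : ℤ) - 2) = k - 2 * ((n + 1 : ℕ) : ℤ) by push_cast; ring]
    ring

/-- `∑_{t<N} (t+1)^{-3/2} ≤ 3`. [folklore] -/
theorem sum_range_rpow_le (N : ℕ) : ∑ t ∈ Finset.range N, ((t : ℝ) + 1) ^ (-(3 / 2 : ℝ)) ≤ 3 := by
  rcases Nat.eq_zero_or_pos N with rfl | hN
  · simp
  have hanti : AntitoneOn (fun x : ℝ => x ^ (-(3 / 2 : ℝ))) (Icc ((1 : ℕ) : ℝ) ((N : ℕ) : ℝ)) := by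
    intro x hx y _ hxy
    have hx1 : (1 : ℝ) ≤ x := by exact_mod_cast hx.1
    exact Real.rpow_le_rpow_of_nonpos (by linarith) hxy (by norm_num)
  have hcmp := AntitoneOn.sum_le_integral_Ico hN hanti
  have hint : ∫ x in ((1 : ℕ) : ℝ)..((N : ℕ) : ℝ), x ^ (-(3 / 2 : ℝ)) ≤ 2 := by
    have h0 : (0 : ℝ) ∉ uIcc ((1 : ℕ) : ℝ) ((N : ℕ) : ℝ) := by
      rw [uIcc_of_le (by exact_mod_cast hN)]; intro h; have := h.1; norm_num at this
    rw [integral_rpow (Or.inr ⟨by norm_num, h0⟩)]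
    have hNpos : (0 : ℝ) < N := by exact_mod_cast hN
    have h1 : 0 ≤ (N : ℝ) ^ (-(3 / 2 : ℝ) + 1) := Real.rpow_nonneg hNpos.le _
    have h2 : ((1 : ℕ) : ℝ) ^ (-(3 / 2 : ℝ) + 1) = 1 := by simp
    rw [h2, show (-(3 / 2 : ℝ) + 1) = -(1 / 2 : ℝ) by norm_num] at *
    rw [div_le_iff_of_neg (by norm_num : (-(1 / 2 : ℝ)) < 0)]
    linarith
  have hsplit : ∑ t ∈ Finset.range N, ((t : ℝ) + 1) ^ (-(3 / 2 : ℝ)) =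
      1 + ∑ i ∈ Finset.Ico 1 N, (((i + 1 : ℕ) : ℝ)) ^ (-(3 / 2 : ℝ)) := by
    rw [Finset.range_eq_Ico, Finset.sum_eq_sum_Ico_succ_bot hN]
    congr 1
    · norm_num
    · refine Finset.sum_congr rfl fun i _ => ?_
      push_cast; ring_nf
  rw [hsplit]
  linarith [hcmp.trans hint]

/-- `∑_{t ∈ T} (t+1)^{-3/2} ≤ 3` for any finite set `T ⊆ ℕ`. [folklore] -/
theorem sum_finset_rpow_le (T : Finset ℕ) : ∑ t ∈ T, ((t : ℝ) + 1) ^ (-(3 / 2 : ℝ)) ≤ 3 := by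
  have hsub : T ⊆ Finset.range (T.sup id + 1) := by
    intro t ht
    rw [Finset.mem_range]
    have := Finset.le_sup (f := id) ht
    simp only [id] at this
    omega
  refine (Finset.sum_le_sum_of_subset_of_nonneg hsub fun t _ _ => Real.rpow_nonneg (by positivity) _).trans ?_
  exact sum_range_rpow_le _

/-- The comparison `1/(‖a‖√‖a‖) ≤ 3 (|k| + 1)^{-3/2}`. [folklore] -/
theorem inv_norm_mul_sqrt_le (k : ℤ) {s : ℕ} (hs : 1 ≤ s) :
    1 / (‖slitParam k s‖ * Real.sqrt ‖slitParam k s‖) ≤ 3 * ((|(k : ℝ)| + 1) ^ (-(3 / 2 : ℝ))) := by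
  set n := ‖slitParam k s‖ with hn
  have hn1 : 1 ≤ n := one_le_norm_slitParam k hs
  have hn0 : 0 < n := by linarith
  have hk : |(k : ℝ)| ≤ n := by rw [hn, ← slitParam_im k s]; exact abs_im_le_norm _
  have h1 : (|(k : ℝ)| + 1) / 2 ≤ n := by linarith
  have h32 : n * Real.sqrt n = n ^ (3 / 2 : ℝ) := by
    rw [Real.sqrt_eq_rpow, show (3 / 2 : ℝ) = 1 + 1 / 2 by norm_num, Real.rpow_add hn0, Real.rpow_one]
  rw [h32, one_div, ← Real.rpow_neg hn0.le]
  have h2 : n ^ (-(3 / 2 : ℝ)) ≤ ((|(k : ℝ)| + 1) / 2) ^ (-(3 / 2 : ℝ)) :=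
    Real.rpow_le_rpow_of_nonpos (by positivity) h1 (by norm_num)
  refine h2.trans ?_
  rw [Real.div_rpow (by positivity) (by norm_num), Real.rpow_neg (by norm_num : (0 : ℝ) ≤ 2), div_inv_eq_mul, mul_comm]
  -- `2^{3/2} = (√2)³ ≤ 3`
  have h23 : (2 : ℝ) ^ (3 / 2 : ℝ) ≤ 3 := by
    rw [show (3 / 2 : ℝ) = (1 / 2 : ℝ) * 3 by norm_num, Real.rpow_mul (by norm_num), ← Real.sqrt_eq_rpow,
      show (3 : ℝ) = ((3 : ℕ) : ℝ) by norm_num, Real.rpow_natCast]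
    have hs : Real.sqrt 2 ≤ 3 / 2 := by
      rw [Real.sqrt_le_left (by norm_num)]; norm_num
    have hs0 : 0 ≤ Real.sqrt 2 := Real.sqrt_nonneg 2
    have hs2 : Real.sqrt 2 * Real.sqrt 2 = 2 := Real.mul_self_sqrt (by norm_num)
    push_cast
    nlinarith
  exact mul_le_mul_of_nonneg_right h23 (Real.rpow_nonneg (by positivity) _)

/-- **The uniform bound on the error sum**: `∑_{j<J} 1/(‖a_j‖√‖a_j‖) ≤ 18`, `a_j = s + i(k - 2j)`. [folklore] -/
theorem sum_inv_norm_mul_sqrt_le (k : ℤ) {s : ℕ} (hs : 1 ≤ s) (J : ℕ) :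
    ∑ j ∈ Finset.range J, 1 / (‖slitParam (k - 2 * j) s‖ * Real.sqrt ‖slitParam (k - 2 * j) s‖) ≤ 18 := by
  set g : ℕ → ℝ := fun t => ((t : ℝ) + 1) ^ (-(3 / 2 : ℝ)) with hg
  have hg0 : ∀ t, 0 ≤ g t := fun t => Real.rpow_nonneg (by positivity) _
  -- each term is at most `3 g(|k - 2j|)`
  have hterm : ∀ j : ℕ, 1 / (‖slitParam (k - 2 * j) s‖ * Real.sqrt ‖slitParam (k - 2 * j) s‖) ≤ 3 * g ((k - 2 * j).natAbs) := by
    intro j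
    refine (inv_norm_mul_sqrt_le (k - 2 * j) hs).trans (le_of_eq ?_)
    simp only [hg]
    congr 2
    rw [Nat.cast_natAbs, Int.cast_abs]
  refine (Finset.sum_le_sum fun j _ => hterm j).trans ?_
  rw [← Finset.mul_sum]
  -- split according to the sign of `k - 2j`
  set S := Finset.range J with hS
  set Sp := S.filter (fun j : ℕ => 0 ≤ k - 2 * (j : ℤ)) with hSp
  set Sm := S.filter (fun j : ℕ => ¬ 0 ≤ k - 2 * (j : ℤ)) with hSm
  have hsplit : ∑ j ∈ S, g ((k - 2 * (j : ℤ)).natAbs) = ∑ j ∈ Sp, g ((k - 2 * (j : ℤ)).natAbs) + ∑ j ∈ Sm, g ((k - 2 * (j : ℤ)).natAbs) :=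
    (Finset.sum_filter_add_sum_filter_not S (fun j : ℕ => 0 ≤ k - 2 * (j : ℤ)) (fun j : ℕ => g ((k - 2 * (j : ℤ)).natAbs))).symm
  -- on each part `j ↦ |k - 2j|` is injective
  have hinjp : Set.InjOn (fun j : ℕ => (k - 2 * j).natAbs) Sp := by
    intro j hj j' hj' h
    simp only [hSp, Finset.coe_filter, Set.mem_setOf_eq] at hj hj'
    have := congrArg (fun n : ℕ => (n : ℤ)) h
    simp only [Int.natAbs_of_nonneg hj.2, Int.natAbs_of_nonneg hj'.2] at this
    omega
  have hinjm : Set.InjOn (fun j : ℕ => (k - 2 * j).natAbs) Sm := by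
    intro j hj j' hj' h
    simp only [hSm, Finset.coe_filter, Set.mem_setOf_eq, not_le] at hj hj'
    have h1 : ((k - 2 * j).natAbs : ℤ) = -(k - 2 * j) := Int.ofNat_natAbs_of_nonpos hj.2.le
    have h2 : ((k - 2 * j').natAbs : ℤ) = -(k - 2 * j') := Int.ofNat_natAbs_of_nonpos hj'.2.le
    have := congrArg (fun n : ℕ => (n : ℤ)) h
    simp only at this
    omega
  have hp : ∑ j ∈ Sp, g ((k - 2 * j).natAbs) ≤ 3 := by
    rw [← Finset.sum_image hinjp]; exact sum_finset_rpow_le _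
  have hm : ∑ j ∈ Sm, g ((k - 2 * j).natAbs) ≤ 3 := by
    rw [← Finset.sum_image hinjm]; exact sum_finset_rpow_le _
  rw [hsplit]
  linarith

/-- **`G = M + O(1)`, uniformly**: for `s ≥ 1` and all `k`,
`|G(k, s) - √(2/π) Re[e^{-iπ/4} √(s + ik)]| ≤ 1.1·10¹⁰`. Since `M ≍ √‖a‖`, this is the
quantitative closed form of the convergence `ν(δ)⁻¹ G_{[ℂ_δ,a]} → Re √(z - a)` of Lemma 2.16
(and of the growth `G = O(|z - a|^{1/2})`). [cite: ChelkakHonglerIzyurovAnnals2015, Lemma 2.16] -/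
theorem abs_slitG_sub_slitM_le (k : ℤ) {s : ℕ} (hs : 1 ≤ s) : |slitG k s - slitM k s| ≤ 11000000000 := by
  -- the truncated differences
  have hD : ∀ J : ℕ, |(slitG k s - slitM k s) - (slitG (k - 2 * J) s - slitM (k - 2 * J) s)| ≤ 11000000000 := by
    intro J
    have h1 := slitG_sub_iter k s J
    have h2 := slitM_sub_iter k s J
    have heq : (slitG k s - slitM k s) - (slitG (k - 2 * J) s - slitM (k - 2 * J) s) =
        ∑ j ∈ Finset.range J, (slitKernel (k - 2 * j) s - (slitM (k - 2 * j) s - slitM (k - 2 * j - 2) s)) := by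
      rw [Finset.sum_sub_distrib, ← h1, ← h2]; ring
    rw [heq]
    refine (Finset.abs_sum_le_sum_abs _ _).trans ?_
    have hsum := sum_inv_norm_mul_sqrt_le k hs J
    calc ∑ j ∈ Finset.range J, |slitKernel (k - 2 * j) s - (slitM (k - 2 * j) s - slitM (k - 2 * j - 2) s)|
        ≤ ∑ j ∈ Finset.range J, 600000009 / (‖slitParam (k - 2 * j) s‖ * Real.sqrt ‖slitParam (k - 2 * j) s‖) :=
          Finset.sum_le_sum fun j _ => abs_slitKernel_sub_slitM_sub_le (k - 2 * j) hs
      _ = 600000009 * ∑ j ∈ Finset.range J, 1 / (‖slitParam (k - 2 * j) s‖ * Real.sqrt ‖slitParam (k - 2 * j) s‖) := by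
          rw [Finset.mul_sum]; refine Finset.sum_congr rfl fun j _ => ?_; ring
      _ ≤ 600000009 * 18 := by gcongr
      _ ≤ 11000000000 := by norm_num
  -- let `J → ∞`
  have hJ : Tendsto (fun J : ℕ => k - 2 * (J : ℤ)) atTop atBot := by
    refine tendsto_atBot.2 fun b => ?_
    refine Filter.eventually_atTop.2 ⟨(k - b).toNat, fun J hJ => ?_⟩
    have : (k - b).toNat ≤ (J : ℤ) := by exact_mod_cast hJ
    omega
  have hG := (tendsto_slitG_atBot s).comp hJ
  have hM := (tendsto_slitM_atBot hs).comp hJ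
  have hlim : Tendsto (fun J : ℕ => |(slitG k s - slitM k s) - (slitG (k - 2 * J) s - slitM (k - 2 * J) s)|) atTop
      (𝓝 |(slitG k s - slitM k s) - (0 - 0)|) :=
    ((tendsto_const_nhds.sub (hG.sub hM)).abs)
  rw [sub_zero, sub_zero] at hlim
  exact le_of_tendsto' hlim hD

/-! ### The two-sided estimate of `ϑ(δ)` (CHI (2.16)): `1/(2√m) ≤ binom(2m,m)/4^m ≤ 1/√(2m+1)` -/

/-- **Lower Wallis bound**: `binom(2m, m)/4^m ≥ 1/(2√m)` for `m ≥ 1` (induction on the ratio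
`(2m+1)/(2m+2)`). With `slitKernel_two_mul_natCast_zero_le` this is the two-sided estimate
`const·δ^{1/2} ≤ ϑ(δ) ≤ Const·δ^{1/2}` of the normalising factor. [cite: ChelkakHonglerIzyurovAnnals2015, Lemma 2.16 (2.16)] -/
theorem centralBinom_div_four_pow_ge {m : ℕ} (hm : 1 ≤ m) : 1 / (2 * Real.sqrt m) ≤ (m.centralBinom : ℝ) / 4 ^ m := by
  induction m with
  | zero => omega
  | succ n ih =>
    rcases Nat.eq_zero_or_pos n with rfl | hn
    · have : Nat.centralBinom 1 = 2 := by decide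
      rw [this]; norm_num
    have ih' := ih hn
    have hrec : ((n + 1 : ℕ) : ℝ) * ((n + 1).centralBinom : ℝ) = 2 * (2 * n + 1) * (n.centralBinom : ℝ) := by
      exact_mod_cast Nat.succ_mul_centralBinom_succ n
    have hn0 : (0 : ℝ) < n := by exact_mod_cast hn
    have hsn : 0 < Real.sqrt n := Real.sqrt_pos.2 hn0
    have hsn1 : 0 < Real.sqrt ((n + 1 : ℕ) : ℝ) := Real.sqrt_pos.2 (by positivity)
    -- `P_{n+1} = P_n (2n+1)/(2n+2)`
    have hP : (((n + 1).centralBinom : ℝ)) / 4 ^ (n + 1) = (n.centralBinom : ℝ) / 4 ^ n * ((2 * n + 1) / (2 * n + 2)) := by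
      have h1 : ((n + 1).centralBinom : ℝ) = 2 * (2 * n + 1) * (n.centralBinom : ℝ) / (n + 1) := by
        rw [eq_div_iff (by positivity)]; push_cast at hrec; linarith
      rw [h1, pow_succ]; field_simp; ring
    rw [hP]
    -- `1/(2√(n+1)) ≤ [1/(2√n)] · (2n+1)/(2n+2)`
    have key : 1 / (2 * Real.sqrt ((n + 1 : ℕ) : ℝ)) ≤ 1 / (2 * Real.sqrt n) * ((2 * n + 1) / (2 * n + 2)) := by
      rw [div_mul_div_comm, one_mul, div_le_div_iff₀ (by positivity) (by positivity), one_mul]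
      -- `2√n (2n+2) ≤ (2n+1) · 2√(n+1)` iff `(n+1)·n·4 ≤ (2n+1)²`… square both sides
      have h2 : (Real.sqrt n * (2 * n + 2)) ^ 2 ≤ ((2 * n + 1) * Real.sqrt ((n + 1 : ℕ) : ℝ)) ^ 2 := by
        rw [mul_pow, mul_pow, Real.sq_sqrt hn0.le, Real.sq_sqrt (by positivity)]
        push_cast; nlinarith
      have h3 := abs_le_of_sq_le_sq' h2 (by positivity)
      push_cast at h3 ⊢
      nlinarith [h3.2]
    exact key.trans (mul_le_mul_of_nonneg_right ih' (by positivity))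

/-- **`K(2m, 0) ≥ 1/(2√m)`** for `m ≥ 1`: the tip harmonic measure along the cut direction decays no
faster than `m^{-1/2}` (lower half of CHI (2.16)). [cite: ChelkakHonglerIzyurovAnnals2015, Lemma 2.16 (2.16)] -/
theorem slitKernel_two_mul_natCast_zero_ge {m : ℕ} (hm : 1 ≤ m) : 1 / (2 * Real.sqrt m) ≤ slitKernel (2 * m) 0 := by
  rw [slitKernel_two_mul_natCast_zero]; exact centralBinom_div_four_pow_ge hm
end Literature.Probability.LatticeModels
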